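import Literature.AnabelianGeometry.AbsoluteAnabelian.GaloisCyclotome
import Literature.GroupTheory.Transfer.TransferTransitivity
import HarnessLib

/-!
# [AbsTopIII] Cor. 1.10 (i)(a): the system `H ↦ (H^ab)_tors` with Verlagerung arrows is DIRECTED — proof

Mochizuki, *Topics in Absolute Anabelian Geometry III*, §1, Cor. 1.10 (i)(a), manuscript pp. 41–42
(lit key `paper:url-5493eb38cbb7`; journal pagination not held): "`μ_{ℚ/ℤ}(G_k) := lim_{→ H} (H^ab)_tors`
[...] where `H` ranges over the open subgroups of `G_k` [...] the arrows of the direct limit are induced by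
the Verlagerung, or transfer, map."

This PROOF-ONLY companion of `GaloisCyclotome.lean` (abc-iut-L4-t1: `verlagerung`, `verlagerungTorsion`,
`muQZSystem`, `muQZ`, `muQZ.of`; that file records "transitivity of the Verlagerung (so Mathlib's
`DirectedSystem` instance is not provided)") supplies exactly that missing functoriality, from the
general transitivity of the transfer (`Literature.GroupTheory.Transfer.transfer_transfer`, companion
`GroupTheory/Transfer/TransferTransitivity.lean`; not in Mathlib):

* `verlagerung_refl`, `verlagerung_trans` (and `verlagerungTorsion_refl`, `verlagerungTorsion_trans`) —
  `Ver_{U,U} = id` and `Ver_{V,W} ∘ Ver_{U,V} = Ver_{U,W}` for open subgroups `W ≤ V ≤ U` of a compact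
  group (the inner transfer on `↥V` is transported to the subgroup `V.subgroupOf U` of `↥U` by
  `transfer_apply_mulEquiv`, then `transfer_transfer` applies);
* `muQZSystem.directedSystem` — `DirectedSystem _ (muQZSystem G)` (a Prop-valued class, stated as a
  theorem so that this file declares no data; use `haveI := muQZSystem.directedSystem G`);
* consequences now available from Mathlib's direct-limit API: `muQZ.of_eq_zero_iff` (exactness:
  an element of `(U^ab)_tors` dies in `μ_{ℚ/ℤ}(G)` iff some Verlagerung kills it) and
  `muQZ.of_injective_of_verlagerungTorsion_injective` (injective transition maps ⇒ injective structure
  maps — the situation of `G = G_k`, `k` an MLF, where the Verlagerung on torsion is the inclusion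
  `μ(k_U) ⊆ μ(k_V)` under local class field theory; that comparison is NOT used or claimed here).

No new definitions; nothing here bears on the disputed parts of IUT — this is topological group theory.
-/

noncomputable section

open scoped Pointwise

universe u

namespace Literature.AnabelianGeometry.AbsoluteAnabelian

open Literature.GroupTheory.Transfer

/-! ### The Verlagerung is functorial: identity and transitivity -/

section VerlagerungFunctorial

variable {G : Type u} [Group G] [TopologicalSpace G] [IsTopologicalGroup G] [CompactSpace G]
  {U V W : Subgroup G}

/-- `Ver_{U,U} = id`: the Verlagerung of [AbsTopIII] Cor. 1.10 (i)(a) along the identity inclusion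
`U ≤ U` is the identity of `U^ab` (transfer along a subgroup of index one).
[cite: MochizukiAbsTopIII2015, Cor 1.10 (i) p.42] -/
theorem verlagerung_refl (hU : IsOpen (U : Set G)) (x : TopologicalAbelianization U) :
    verlagerung hU hU le_rfl x = x := by
  induction x using QuotientGroup.induction_on with
  | H u =>
    rw [verlagerung_mk]
    unfold transferToAbelianization
    haveI := finiteIndex_subgroupOf hU hU (U := U) (V := U)
    rw [transfer_eq_of_forall_mem (fun v : U => Subgroup.mem_subgroupOf.mpr v.2)]
    rfl

/-- **Transitivity of the Verlagerung**: for open subgroups `W ≤ V ≤ U` of a compact group,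
`Ver_{V,W} ∘ Ver_{U,V} = Ver_{U,W}` on `U^ab` — "the arrows of the direct limit are induced by the
Verlagerung" ([AbsTopIII] Cor. 1.10 (i)(a) p. 42) compose as they must for a direct system
(transitivity of the transfer, `Literature.GroupTheory.Transfer.transfer_transfer`).
[cite: MochizukiAbsTopIII2015, Cor 1.10 (i) p.42] -/
theorem verlagerung_trans (hU : IsOpen (U : Set G)) (hV : IsOpen (V : Set G))
    (hW : IsOpen (W : Set G)) (hVU : V ≤ U) (hWV : W ≤ V) (x : TopologicalAbelianization U) :
    verlagerung hV hW hWV (verlagerung hU hV hVU x) = verlagerung hU hW (hWV.trans hVU) x := by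
  haveI := finiteIndex_subgroupOf hU hV (U := U) (V := V)
  haveI := finiteIndex_subgroupOf hU hW (U := U) (V := W)
  haveI := finiteIndex_subgroupOf hV hW (U := V) (V := W)
  induction x using QuotientGroup.induction_on with
  | H u =>
    rw [verlagerung_mk, verlagerung_mk]
    unfold transferToAbelianization
    -- naturality of the outer transfer in the coefficients
    rw [← MonoidHom.comp_apply (verlagerung hV hW hWV), ← transfer_comp]
    -- the subgroups of `U` involved
    set V' : Subgroup U := V.subgroupOf U with hV'
    set W' : Subgroup U := W.subgroupOf U with hW'
    have hWV' : W' ≤ V' := fun x hx => hWV hx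
    -- the inner transfer, transported from `↥V` to `↥V'`, is a transfer along `W'.subgroupOf V'`
    have key : (verlagerung hV hW hWV).comp (toAbelianizationOfLe hVU) =
        MonoidHom.transfer ((toAbelianizationOfLe (hWV.trans hVU)).comp
          (Subgroup.subgroupOfEquivOfLe hWV').toMonoidHom) := by
      ext x
      rw [MonoidHom.comp_apply]
      have h1 : toAbelianizationOfLe hVU x =
          QuotientGroup.mk (Subgroup.subgroupOfEquivOfLe hVU x) := rfl
      rw [h1, verlagerung_mk]
      unfold transferToAbelianization
      rw [transfer_apply_mulEquiv (Subgroup.subgroupOfEquivOfLe hVU) (H := W.subgroupOf V)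
        (H' := W'.subgroupOf V') (fun z => by
          simp only [Subgroup.mem_subgroupOf]
          rfl)]
      congr 1
    rw [key]
    exact congrFun (congrArg DFunLike.coe (transfer_transfer hWV' _)) u

/-- `Ver_{U,U} = id` on torsion subgroups. [cite: MochizukiAbsTopIII2015, Cor 1.10 (i) p.42] -/
theorem verlagerungTorsion_refl (hU : IsOpen (U : Set G)) (x : abelianizationTorsion U) :
    verlagerungTorsion hU hU le_rfl x = x :=
  Subtype.ext (verlagerung_refl hU x)

/-- Transitivity of the Verlagerung on torsion subgroups `(U^ab)_tors → (V^ab)_tors → (W^ab)_tors`.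
[cite: MochizukiAbsTopIII2015, Cor 1.10 (i) p.42] -/
theorem verlagerungTorsion_trans (hU : IsOpen (U : Set G)) (hV : IsOpen (V : Set G))
    (hW : IsOpen (W : Set G)) (hVU : V ≤ U) (hWV : W ≤ V) (x : abelianizationTorsion U) :
    verlagerungTorsion hV hW hWV (verlagerungTorsion hU hV hVU x) =
      verlagerungTorsion hU hW (hWV.trans hVU) x :=
  Subtype.ext (verlagerung_trans hU hV hW hVU hWV x)

end VerlagerungFunctorial

/-! ### `H ↦ (H^ab)_tors` is a directed system; consequences for `μ_{ℚ/ℤ}(G)` -/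

section Directed

variable (G : Type u) [Group G] [TopologicalSpace G] [IsTopologicalGroup G] [CompactSpace G]

open scoped Classical in
/-- **The system `U ↦ (U^ab)_tors` of [AbsTopIII] Cor. 1.10 (i)(a) (transition maps = Verlagerung,
`muQZSystem`) is a DIRECTED SYSTEM in Mathlib's sense** (`Ver_{U,U} = id`, `Ver ∘ Ver = Ver`), so the
full `AddCommGroup.DirectLimit` API (exactness `of.zero_exact`, lifts, cofinal subsystems) applies to
`μ_{ℚ/ℤ}(G) = muQZ G`.  Stated as a theorem (Prop-valued class); use `haveI := muQZSystem.directedSystem G`.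
[cite: MochizukiAbsTopIII2015, Cor 1.10 (i) p.42] -/
theorem muQZSystem.directedSystem :
    DirectedSystem
      (fun U : (OpenSubgroup G)ᵒᵈ =>
        Additive (abelianizationTorsion ((OrderDual.ofDual U : OpenSubgroup G) : Subgroup G)))
      (fun i j h => muQZSystem G i j h) := by
  constructor
  · intro i x
    change Additive.ofMul (verlagerungTorsion _ _ _ (Additive.toMul x)) = x
    rw [verlagerungTorsion_refl]
    rfl
  · intro k j i hij hjk x
    change Additive.ofMul (verlagerungTorsion _ _ _ (Additive.toMul
        (Additive.ofMul (verlagerungTorsion _ _ _ (Additive.toMul x))))) =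
      Additive.ofMul (verlagerungTorsion _ _ _ (Additive.toMul x))
    rw [toMul_ofMul, verlagerungTorsion_trans]

variable {G}

open scoped Classical in
/-- Exactness of the direct limit for `μ_{ℚ/ℤ}(G)`: an element of `(U^ab)_tors` dies in `μ_{ℚ/ℤ}(G)`
iff it dies under the Verlagerung to some smaller open subgroup (Mathlib
`AddCommGroup.DirectLimit.of.zero_exact`, available now that the system is directed).
[cite: MochizukiAbsTopIII2015, Cor 1.10 (i) p.42] -/
theorem muQZ.of_eq_zero_iff (U : OpenSubgroup G) (x : abelianizationTorsion (U : Subgroup G)) :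
    muQZ.of U (Additive.ofMul x) = 0 ↔
      ∃ (V : OpenSubgroup G) (h : V ≤ U),
        verlagerungTorsion U.isOpen V.isOpen (OpenSubgroup.toSubgroup_le.mpr h) x = 1 := by
  haveI := muQZSystem.directedSystem G
  constructor
  · intro hx
    obtain ⟨j, hij, hj⟩ := AddCommGroup.DirectLimit.of.zero_exact (f := muQZSystem G)
      (OrderDual.toDual U) (Additive.ofMul x) hx
    refine ⟨OrderDual.ofDual j, OrderDual.ofDual_le_ofDual.mpr hij, ?_⟩
    exact Additive.ofMul.injective hj
  · rintro ⟨V, hVU, hx⟩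
    rw [← muQZ.of_verlagerung hVU x, hx]
    simp

open scoped Classical in
/-- If every Verlagerung `(U^ab)_tors → (V^ab)_tors` (`V ≤ U` open) is injective, then every
structure map `(U^ab)_tors → μ_{ℚ/ℤ}(G)` is injective (e.g. for `G = G_k`, `k` an MLF, where under local
class field theory the Verlagerung on torsion is the inclusion `μ(k_U) ⊆ μ(k_V)`).
[cite: MochizukiAbsTopIII2015, Cor 1.10 (i) p.42] -/
theorem muQZ.of_injective_of_verlagerungTorsion_injective
    (hinj : ∀ (U V : OpenSubgroup G) (h : V ≤ U),
      Function.Injective (verlagerungTorsion U.isOpen V.isOpen (OpenSubgroup.toSubgroup_le.mpr h)))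
    (U : OpenSubgroup G) : Function.Injective (muQZ.of U) := by
  intro a b hab
  have h0 : muQZ.of U (a - b) = 0 := by rw [map_sub, hab, sub_self]
  have h1 : muQZ.of U (Additive.ofMul (Additive.toMul a / Additive.toMul b)) = 0 := by
    simpa using h0
  obtain ⟨V, hVU, hV⟩ := (muQZ.of_eq_zero_iff U _).mp h1
  have h2 : Additive.toMul a / Additive.toMul b = 1 := by
    apply hinj U V hVU
    rw [hV, map_one]
  have h3 : Additive.toMul a = Additive.toMul b := div_eq_one.mp h2
  exact Additive.toMul.injective h3

end Directed

end Literature.AnabelianGeometry.AbsoluteAnabelian
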